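import Summits.ValiantsHypothesis.ValiantsHypothesis.Theorems.BarrierLeverPartitionMinorsMooreBenchEntries

/-!
# Route BarrierLever — item 22038 `ChowBenchmarkPairs`, line `moore-peel`: the KERNEL-WEIGHTED hierarchical
# Moore peel, I — weighted rows `krow κ`, stage matrices `G^κ_i = kpeelMatrix κ i`, and their entries after the
# one-point substitution

Helper file (`--supports stmt-ValiantsHypothesis-22038`; cell valiant-natproofs, rung V4, 𝒟-side benchmark of
record, line `moore_peel`, card v12 (E)(ii); seat val-np-p4 gen 26).  Closes NO item.  Three definitions
(`kincl`, `kpeelMatrix`, `krow`) and their API; the theorems of the peel live in the companion files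
`…KernelPeelStage`, `…KernelPeelLead`, `…KernelPeel`, and THEOREM M in `…MidpointPoised`.

WHY.  Planner p1 g18's hierarchical Moore peel (`…PartitionMinorsMooreBench*`, Theorem A:
`(∀ i ≤ h, det G_i ≠ 0) → MCBenchPairsAt h`) is typed for the SEGMENT kernel `1/(1-x)`, whose rows carry the
factorial weights `|T∖T_j|!` and whose stage matrices `G_i` die at `i = 183`.  The seat's memo
`HOME/val-np-p4/g25/MEMO-valnp4-g25.md` §4bis observes that the peel is KERNEL-GENERIC: for a weight sequence
`κ : ℕ → ℕ` (kernel `Σ_k κ(k) x^k / k!`; `κ = k!` = segment means, `κ = 1` = `exp` = midpoint evaluations,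
`κ(k) = α(α+1)⋯(α+k-1)` = Dirichlet(α,α) means) the same substitution / scaling / reduction / recombination runs
with the stage matrices `G^κ_i[j,m] = [T_j ⊆ T_{c_i+m}]·κ(|T_{c_i+m}| - |T_j|)`.  This file sets up the weighted
objects, as a verbatim generalisation of `…MooreBench` / `…MooreBenchEntries` (`κ = Nat.factorial` gives those
back: `kincl_factorial`, `kpeelMatrix_factorial`, `krow_factorial`).

* `kincl κ j c = [T_j ⊆ T_c]·κ(|T_c| - |T_j|)`, `kpeelMatrix κ i` (`G^κ_i`, over `ℤ`), `krow κ r Y` (the three kinds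
  of labelled rows: `e_m`; `(T_j,{b}) ↦ [T_j ⊆ T]·κ|T∖T_j|·Y_b^{bin(T∖T_j)}`;
  `(∅,{b,b'}) ↦ Σ_{d⊆T} κ|T∖d|·Y_b^{bin(T∖d)}·κ|d|·Y_{b'}^{bin d}`); `map_krow`, `krow_congr`.
* After `Y_n ↦ X`: `X_pow_mul_krow_single`, `krow_single_sub_fixed` (group `S' = ∅`), `krow_pair_eq_sum`,
  `krow_pair_sub_fixed` (group `S' = {b}`: subtracting `κ|T_{j'}|·X^{j'}·(T_{j'},{b})` leaves the terms
  `bin d ≥ i`), `krow_eq_C_of_mem_stageRows` (fixed rows are constants).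

WHAT THIS IS NOT: no stub of line `moore_peel` is closed; nothing is claimed about the segment-mean benchmark
`stub_segmentMeanValue` (factorial weights, `det G_183 = 0`); nothing on crux stmt-ValiantsHypothesis-14610 or on
`VP` versus `VNP`.
-/

set_option linter.dupNamespace false

namespace Summit.ValiantsHypothesis.ValiantsHypothesis.Theorems.BarrierLever.MoorePeel

open Polynomial Finset

/-! ## 1. Kernel-weighted rows and stage matrices -/

/-- The entries of the unbounded KERNEL-WEIGHTED peel matrix `G̃^κ[j, c] = [T_j ⊆ T_c] · κ(|T_c| - |T_j|)`
(codes read as bit-sets; `κ = Nat.factorial` is `inclFactorial`, `κ = 1` the Boolean zeta matrix). -/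
def kincl (κ : ℕ → ℕ) (j c : ℕ) : ℕ :=
  if bits j ⊆ bits c then κ ((bits c).card - (bits j).card) else 0

/-- The stage-`i` matrix of the kernel-weighted peel: `G^κ_i[j, m] = G̃^κ[j, c_i + m]`, `j, m < i`. -/
def kpeelMatrix (κ : ℕ → ℕ) (i : ℕ) : Matrix (Fin i) (Fin i) ℤ :=
  Matrix.of fun j m => (kincl κ (j : ℕ) (windowStart i + (m : ℕ)) : ℤ)

/-- **The kernel-weighted labelled rows** over a node table `Y : ℕ → R` (cf. `rowVec` = the case
`κ = Nat.factorial`): `e_m`; `(T_j,{b}) ↦ [T_j ⊆ T]·κ(|T∖T_j|)·Y_b^{bin(T∖T_j)}`;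
`(∅,{b,b'}) ↦ Σ_{d⊆T} κ(|T∖d|)·Y_b^{bin(T∖d)} · κ(|d|)·Y_{b'}^{bin d}` (`T = bits col`). -/
def krow {R : Type*} [CommRing R] (κ : ℕ → ℕ) (r : ℕ) (Y : ℕ → R) : RowLabel → (Fin r → R)
  | Sum.inl m => fun col => if (col : ℕ) = m then 1 else 0
  | Sum.inr (Sum.inl (j, b)) => fun col => if bits j ⊆ bits (col : ℕ) then
      ((κ ((bits (col : ℕ)).card - (bits j).card) : ℕ) : R) * Y b ^ bin (bits (col : ℕ) \ bits j)
      else 0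
  | Sum.inr (Sum.inr (b, b')) => fun col => ∑ d ∈ (bits (col : ℕ)).powerset,
      (((κ (bits (col : ℕ) \ d).card : ℕ) : R) * Y b ^ bin (bits (col : ℕ) \ d)) *
        (((κ d.card : ℕ) : R) * Y b' ^ bin d)

/-- `G̃^{!} = G̃`: with factorial weights the kernel entries are `inclFactorial`. -/
theorem kincl_factorial (j c : ℕ) : kincl Nat.factorial j c = inclFactorial j c := rfl

/-- `G^{!}_i = G_i` (`peelMatrix` of `…MooreBench`). -/
theorem kpeelMatrix_factorial (i : ℕ) : kpeelMatrix Nat.factorial i = peelMatrix i := by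
  ext j m
  rw [kpeelMatrix, Matrix.of_apply, kincl_factorial, peelMatrix_eq_inclFactorial]

/-- With factorial weights the kernel rows are the rows `rowVec` of `…MooreBench`. -/
theorem krow_factorial {R : Type*} [CommRing R] (r : ℕ) (Y : ℕ → R) :
    krow Nat.factorial r Y = rowVec r Y := by
  funext x
  rcases x with m | ⟨j, b⟩ | ⟨b, b'⟩ <;> rfl

/-- Entries of the stage matrix. -/
theorem kpeelMatrix_eq_kincl (κ : ℕ → ℕ) (i : ℕ) (j m : Fin i) :
    kpeelMatrix κ i j m = (kincl κ (j : ℕ) (windowStart i + (m : ℕ)) : ℤ) := rfl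

/-- Off its support `G̃^κ` vanishes. -/
theorem kincl_of_not_subset (κ : ℕ → ℕ) {j c : ℕ} (hjc : ¬ bits j ⊆ bits c) : kincl κ j c = 0 := by
  rw [kincl, if_neg hjc]

/-- Ring homomorphisms act on the kernel rows through the node table. -/
theorem map_krow {R S : Type*} [CommRing R] [CommRing S] (φ : R →+* S) (κ : ℕ → ℕ) (r : ℕ)
    (Y : ℕ → R) (x : RowLabel) (col : Fin r) :
    φ (krow κ r Y x col) = krow κ r (fun b => φ (Y b)) x col := by
  rcases x with m | ⟨j, b⟩ | ⟨b, b'⟩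
  · simp only [krow]
    split_ifs <;> simp
  · simp only [krow]
    split_ifs <;> simp
  · simp only [krow, map_sum, map_mul, map_natCast, map_pow]

/-- A kernel row only depends on the node table at its own points. -/
theorem krow_congr {R : Type*} [CommRing R] (κ : ℕ → ℕ) (r : ℕ) (Y Y₂ : ℕ → R) :
    ∀ x : RowLabel, (∀ b : ℕ, (match x with
      | Sum.inl _ => False
      | Sum.inr (Sum.inl (_, b₁)) => b = b₁
      | Sum.inr (Sum.inr (b₁, b₂)) => b = b₁ ∨ b = b₂) → Y b = Y₂ b) →
      krow κ r Y x = krow κ r Y₂ x := by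
  rintro (m | ⟨j, b⟩ | ⟨b, b'⟩) hY
  · rfl
  · funext col
    simp only [krow, hY b rfl]
  · funext col
    simp only [krow, hY b (Or.inl rfl), hY b' (Or.inr rfl)]

/-! ## 2. Entries after the one-point substitution `Y_n ↦ X` -/

section Entries

variable {R : Type*} [CommRing R] (κ : ℕ → ℕ) (r : ℕ)

/-- **The attached rows of the peeled point.**  If `Z n = X` then
`X^j · krow (T_j, {n}) col = C (G̃^κ[j, col]) · X^col`. -/
theorem X_pow_mul_krow_single (Z : ℕ → R[X]) (n : ℕ) (hZ : Z n = X) (j : ℕ) (col : Fin r) :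
    X ^ j * krow κ r Z (Sum.inr (Sum.inl (j, n))) col =
      C ((kincl κ j (col : ℕ) : R)) * X ^ (col : ℕ) := by
  simp only [krow, hZ, kincl]
  split_ifs with hsub
  · rw [mul_left_comm, ← pow_add, add_bin_sdiff_eq hsub, map_natCast]
  · simp

/-- **Group `S' = ∅` after row reduction.**  Subtracting the fixed monomial rows `e_m`, `m < c_i`,
from `X^j · (T_j, {n})` leaves `col ↦ [c_i ≤ col] · C (G̃^κ[j, col]) · X^col`. -/
theorem krow_single_sub_fixed (Z : ℕ → R[X]) (n : ℕ) (hZ : Z n = X) (i j : ℕ) (col : Fin r) :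
    X ^ j * krow κ r Z (Sum.inr (Sum.inl (j, n))) col -
      ∑ m ∈ Finset.range (windowStart i), (C ((kincl κ j m : R)) * X ^ m) *
        (if (col : ℕ) = m then (1 : R[X]) else 0) =
      if (col : ℕ) < windowStart i then 0 else C ((kincl κ j (col : ℕ) : R)) * X ^ (col : ℕ) := by
  rw [X_pow_mul_krow_single κ r Z n hZ j col]
  simp_rw [mul_ite, mul_one, mul_zero]
  rw [Finset.sum_ite_eq (Finset.range (windowStart i)) (col : ℕ)]
  simp only [Finset.mem_range]
  split_ifs with hlt
  · exact sub_self _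
  · exact sub_zero _

/-- **The pair rows through the peeled point.**  If `Z n = X` and `Z b = C y` then
`krow (∅, {b, n}) col = Σ_{d ⊆ T_col} C(κ|T∖d| · y^{bin(T∖d)} · κ|d|) · X^{bin d}`. -/
theorem krow_pair_eq_sum (Z : ℕ → R[X]) (n b : ℕ) (y : R) (hZn : Z n = X) (hZb : Z b = C y)
    (col : Fin r) :
    krow κ r Z (Sum.inr (Sum.inr (b, n))) col = ∑ d ∈ (bits (col : ℕ)).powerset,
      C ((((κ (bits (col : ℕ) \ d).card : ℕ) : R)) * y ^ bin (bits (col : ℕ) \ d) *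
        ((κ d.card : ℕ) : R)) * X ^ bin d := by
  simp only [krow, hZn, hZb]
  refine Finset.sum_congr rfl fun d _ => ?_
  rw [map_mul, map_mul, map_pow, map_natCast, map_natCast]
  ring

/-- **Group `S' = {b}` after row reduction.**  With `Z n = X`, `Z b = C (Y b)`: subtracting
`κ|T_{j'}| · X^{j'} · (T_{j'}, {b})` for `j' < i` from the pair row `(∅, {b, n})` leaves exactly the
terms with `bin d ≥ i`. -/
theorem krow_pair_sub_fixed (Y : ℕ → R) (Z : ℕ → R[X]) (n b i : ℕ) (hZn : Z n = X)
    (hZb : Z b = C (Y b)) (col : Fin r) :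
    krow κ r Z (Sum.inr (Sum.inr (b, n))) col -
      ∑ j' ∈ Finset.range i, (C (((κ (bits j').card : ℕ) : R)) * X ^ j') *
        C (krow κ r Y (Sum.inr (Sum.inl (j', b))) col) =
    ∑ d ∈ (bits (col : ℕ)).powerset.filter (fun d => i ≤ bin d),
      C ((((κ (bits (col : ℕ) \ d).card : ℕ) : R)) * Y b ^ bin (bits (col : ℕ) \ d) *
        ((κ d.card : ℕ) : R)) * X ^ bin d := by
  rw [krow_pair_eq_sum κ r Z n b (Y b) hZn hZb col, sub_eq_iff_eq_add,
    ← Finset.sum_filter_add_sum_filter_not (bits (col : ℕ)).powerset (fun d => i ≤ bin d)]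
  congr 1
  -- the terms with `bin d < i` are the subtracted attached rows, reindexed by `d = bits j'`
  set T := bits (col : ℕ) with hT
  have hsub0 : ∀ j' ∈ Finset.range i, ¬ bits j' ⊆ T →
      (C (((κ (bits j').card : ℕ) : R)) * X ^ j') *
        C (krow κ r Y (Sum.inr (Sum.inl (j', b))) col) = 0 := by
    intro j' _ hj'
    simp only [krow, ← hT, if_neg hj', map_zero, mul_zero]
  rw [← Finset.sum_filter_of_ne (s := Finset.range i) (p := fun j' => bits j' ⊆ T)
    (fun j' hj' hne => by_contra fun hns => hne (hsub0 j' hj' hns))]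
  have himage : (T.powerset.filter fun d => ¬ i ≤ bin d) =
      ((Finset.range i).filter fun j' => bits j' ⊆ T).image bits := by
    ext d
    simp only [Finset.mem_filter, Finset.mem_powerset, Finset.mem_image, Finset.mem_range, not_le]
    constructor
    · rintro ⟨hdT, hdi⟩
      exact ⟨bin d, ⟨hdi, by rwa [bits_bin]⟩, bits_bin d⟩
    · rintro ⟨j', ⟨hj'i, hj'T⟩, rfl⟩
      exact ⟨hj'T, by rwa [bin_bits]⟩
  rw [himage, Finset.sum_image fun a _ b _ e => bits_injective e]
  refine Finset.sum_congr rfl fun j' hj' => ?_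
  have hj'T : bits j' ⊆ T := (Finset.mem_filter.mp hj').2
  simp only [krow, ← hT, if_pos hj'T, bin_bits, Finset.card_sdiff_of_subset hj'T, map_mul, map_pow,
    map_natCast]
  ring

/-- **Fixed rows are constants.**  A row alive at stage `(i, n)` involves only points `< n`; if the
node table `Z` is `C ∘ Y` there, the row over `R[X]` is the constant row `C ∘ krow κ r Y x`. -/
theorem krow_eq_C_of_mem_stageRows (Y : ℕ → R) (Z : ℕ → R[X]) (i n : ℕ)
    (hZ : ∀ b, b < n → Z b = C (Y b)) (x : RowLabel) (hx : x ∈ stageRows i n) (col : Fin r) :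
    krow κ r Z x col = C (krow κ r Y x col) := by
  rw [map_krow]
  rcases x with m | ⟨j, b⟩ | ⟨b, b'⟩
  · rfl
  · have hb : b < n := (inr_inl_mem_stageRows.mp hx).2
    rw [krow_congr κ r Z (fun b => C (Y b)) (Sum.inr (Sum.inl (j, b)))
      (fun b₁ hb₁ => by rw [hb₁]; exact hZ b hb)]
  · have hbb : b < b' ∧ b' < n := inr_inr_mem_stageRows.mp hx
    rw [krow_congr κ r Z (fun b => C (Y b)) (Sum.inr (Sum.inr (b, b')))
      (fun b₁ hb₁ => by
        rcases hb₁ with e | e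
        · rw [e]; exact hZ b (lt_trans hbb.1 hbb.2)
        · rw [e]; exact hZ b' hbb.2)]

end Entries

end Summit.ValiantsHypothesis.ValiantsHypothesis.Theorems.BarrierLever.MoorePeel
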